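import Mathlib.Analysis.Calculus.Deriv.Shift
import Literature.Analysis.FluidPDE.KwonMollifiedDriftSmooth
import HarnessLib

/-!
# Kwon's time-mollified drift: the time derivative through the Navier–Stokes equations

Analysis/FluidPDE proof file (theorems only) on the discharge path of the named fact
`Literature.Analysis.FluidPDE.kwon2023_velocity_epsilon_regularity`
(`PressureFreeEpsilonRegularity.lean`; H. Kwon, J. Differential Equations (2023) =
arXiv:2104.03160, Thm. 1.4). Continuing `KwonDriftTimeDerivativeWeak` (the weak time derivative
of `t ↦ ⟪h(t,x),c⟫`, `h = driftField W`) and `KwonMollifiedDriftSmooth` (the time-mollified drift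
`h_ρ = ρ ⋆_t h` is jointly smooth): for a distributional Navier–Stokes solution `(u, p)` on
`Q₂(0)`, its good representative `W`, a bump `ρ` of radius `r` and `t` with
`−4 + r < t < −r`,

  `d/dt ⟪h_ρ(t,x), c⟫ = ∫ ρ(t − s) g_{x,c}(s) ds`,
  `g_{x,c}(s) = ∫ (⟪W,(W·∇)η_{x,c}⟫ + ⟪W, Δη_{x,c}⟫ + p div η_{x,c})(s,y) dy`

(`Kwon2023.hasDerivAt_inner_timeConv_driftField`): the time derivative of the mollified drift IS
the mollification of the Navier–Stokes right-hand side tested against the kernel of `H` — the form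
in which `∂ₜh` enters the local energy balance of `v = u − h` in the proof of Lemma 2.5 (p. 8–9).
No NS-regularity statement is touched.

## Mathlib / tree search

Tree (reused): `integral_deriv_mul_inner_driftField_eq` (`KwonDriftTimeDerivativeWeak`),
`driftField`, `stronglyMeasurable_uncurry_driftField` (`KwonSpaceTimeFields`),
`exists_forall_norm_driftField_le` (`KwonDriftBounds` via `KwonDecompositionMomentum`:
`exists_norm_driftField_le_const`). Mathlib: `HasCompactSupport.hasDerivAt_convolution_left`,
`HasDerivAt.inner`, `ContDiffBump.normed`, `ContDiffBump.support_normed_eq`, `deriv_comp_const_sub`,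
`convolution_eq_swap`, `integral_inner`, `LocallyIntegrable.mono`.

## References

* H. Kwon, *The role of the pressure in the regularity theory for the Navier–Stokes equations*,
  J. Differential Equations 357 (2023) = arXiv:2104.03160: Remark 2.3 (2.3) and Lemma 2.5 (proof,
  p. 8–9). [Kwon2023RolePressure]
-/

noncomputable section

open MeasureTheory Set Function Filter Topology TopologicalSpace Metric InnerProductSpace
  ContinuousLinearMap
open scoped NNReal ENNReal RealInnerProductSpace Convolution ContDiff Laplacian

namespace Literature.Analysis.FluidPDE

namespace Kwon2023

variable {u W : ℝ → EuclideanSpace ℝ (Fin 3) → EuclideanSpace ℝ (Fin 3)} {p : ℝ → EuclideanSpace ℝ (Fin 3) → ℝ}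

/-- `σ ↦ h(σ, x)` is strongly measurable. [folklore] -/
private theorem stronglyMeasurable_driftField_at (hW : IsGoodVelocity W) (x : EuclideanSpace ℝ (Fin 3)) :
    StronglyMeasurable (fun σ : ℝ => driftField W σ x) := by
  have hg : Measurable (fun σ : ℝ => ((σ, x) : ℝ × EuclideanSpace ℝ (Fin 3))) := measurable_prodMk_right
  have h0 := (stronglyMeasurable_uncurry_driftField hW).comp_measurable hg
  have e : (uncurry (driftField W) ∘ fun σ : ℝ => ((σ, x) : ℝ × EuclideanSpace ℝ (Fin 3))) =
      fun σ => driftField W σ x := by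
    funext σ; simp only [Function.comp_apply, Function.uncurry_apply_pair]
  rw [e] at h0
  exact h0

/-- `σ ↦ h(σ, x)` is locally integrable (bounded and measurable). [folklore] -/
private theorem locallyIntegrable_driftField_at (hW : IsGoodVelocity W) (x : EuclideanSpace ℝ (Fin 3)) :
    LocallyIntegrable (fun σ : ℝ => driftField W σ x) volume := by
  obtain ⟨M, -, hM⟩ := exists_norm_driftField_le_const hW
  refine (locallyIntegrable_const M).mono (stronglyMeasurable_driftField_at hW x).aestronglyMeasurable
    (Eventually.of_forall fun σ => ?_)
  rw [Real.norm_of_nonneg ((norm_nonneg _).trans (hM σ x))]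
  exact hM σ x

/-- **The time derivative of the mollified drift through the Navier–Stokes equations.** For a
distributional Navier–Stokes solution `(u, p)` on `Q₂(0)` (`ν = 1`, `f = 0`), its good
representative `W`, `h = driftField W`, a bump `ρ` (radius `r = ρ.rOut`) and `−4 + r < t < −r`:
`d/dt ⟪(ρ ⋆_t h(·,x))(t), c⟫ = ∫ ρ(t − s) (∫ (⟪W,(W·∇)η_{x,c}⟫ + ⟪W, Δη_{x,c}⟫ + p div η_{x,c})(s,y) dy) ds`
with the adjoint field `η_{x,c}(y) = ⟪∇k(x − y), c⟫ ∇φ(y) − (c × ∇k(x − y)) × ∇φ(y)` — the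
derivative of the time mollification is `ρ' ⋆ h`, and `ρ'(t − ·)` is an admissible test function
in the weak time-derivative identity of the drift.
[cite: Kwon2023RolePressure, Lemma 2.5 (proof, p. 8–9) with Remark 2.3 (2.3)] -/
theorem hasDerivAt_inner_timeConv_driftField (hW : IsGoodVelocity W)
    (hu : IsDistributionalNSSolutionOn (parabolicCylinderOpens 2 (0 : ℝ × EuclideanSpace ℝ (Fin 3))) 1 0 u p)
    (hWu : uncurry W =ᵐ[volume]
      (parabolicCylinder 2 (0 : ℝ × EuclideanSpace ℝ (Fin 3))).indicator (uncurry u))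
    (φ : ContDiffBump (0 : ℝ)) (x c : EuclideanSpace ℝ (Fin 3)) {t : ℝ}
    (ht₁ : -4 + φ.rOut < t) (ht₂ : t + φ.rOut < 0) :
    HasDerivAt (fun t => ⟪(φ.normed volume ⋆[lsmul ℝ ℝ, volume] fun σ => driftField W σ x) t, c⟫)
      (∫ s, φ.normed volume (t - s) *
        ∫ y, (⟪W s y, fderiv ℝ (fun y => ⟪gradient annularKernel (x - y), c⟫ • gradient kwonCutoff y -
            cross (cross c (gradient annularKernel (x - y))) (gradient kwonCutoff y)) y (W s y)⟫ +
          ⟪W s y, Δ (fun y => ⟪gradient annularKernel (x - y), c⟫ • gradient kwonCutoff y -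
            cross (cross c (gradient annularKernel (x - y))) (gradient kwonCutoff y)) y⟫ +
          p s y * VectorCalculus.divergence (fun y => ⟪gradient annularKernel (x - y), c⟫ • gradient kwonCutoff y -
            cross (cross c (gradient annularKernel (x - y))) (gradient kwonCutoff y)) y)) t := by
  set ρ : ℝ → ℝ := φ.normed volume with hρ
  set hx : ℝ → EuclideanSpace ℝ (Fin 3) := fun σ => driftField W σ x with hhx
  have hρd : ContDiff ℝ 1 ρ := φ.contDiff_normed
  have hρc : HasCompactSupport ρ := φ.hasCompactSupport_normed
  have hli := locallyIntegrable_driftField_at hW x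
  -- `(ρ ⋆ h)' = ρ' ⋆ h`
  have hconv : HasDerivAt (ρ ⋆[lsmul ℝ ℝ, volume] hx) ((deriv ρ ⋆[lsmul ℝ ℝ, volume] hx) t) t :=
    hρc.hasDerivAt_convolution_left (lsmul ℝ ℝ) hρd hli t
  have hinner := hconv.inner ℝ (hasDerivAt_const t c)
  simp only [inner_zero_right, zero_add] at hinner
  -- the test function `χ(s) = ρ(t − s)`
  set χ : ℝ → ℝ := fun s => ρ (t - s) with hχdef
  have hχ : ContDiff ℝ ∞ χ := φ.contDiff_normed.comp (contDiff_const.sub contDiff_id)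
  have hχsupp : support χ ⊆ Icc (t - φ.rOut) (t + φ.rOut) := by
    intro s hs
    have h1 : t - s ∈ support ρ := hs
    rw [hρ, φ.support_normed_eq, mem_ball_zero_iff, Real.norm_eq_abs, abs_lt] at h1
    constructor <;> linarith [h1.1, h1.2]
  have hχc : HasCompactSupport χ :=
    IsCompact.of_isClosed_subset isCompact_Icc (isClosed_tsupport χ)
      (closure_minimal hχsupp isClosed_Icc)
  have hχI : tsupport χ ⊆ Ioo (-4 : ℝ) 0 :=
    (closure_minimal hχsupp isClosed_Icc).trans fun s hs => ⟨by linarith [hs.1], by linarith [hs.2]⟩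
  have hχ' : ∀ s, deriv χ s = -deriv ρ (t - s) := fun s => by
    rw [hχdef]; exact deriv_comp_const_sub ρ t s
  have weak := integral_deriv_mul_inner_driftField_eq hW hu hWu hχ hχc hχI x c
  -- `⟪(ρ' ⋆ h)(t), c⟫ = ∫ ρ'(t − s) ⟪h(s,x), c⟫ ds`
  obtain ⟨M, -, hM⟩ := exists_norm_driftField_le_const hW
  have hdc : Continuous fun s => deriv ρ (t - s) :=
    (hρd.continuous_deriv le_rfl).comp (continuous_const.sub continuous_id)
  have hdcs : HasCompactSupport fun s => deriv ρ (t - s) := by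
    refine HasCompactSupport.intro (isCompact_Icc (a := t - φ.rOut) (b := t + φ.rOut)) fun s hs => ?_
    have h1 : t - s ∉ tsupport ρ := by
      rw [hρ, φ.tsupport_normed_eq, mem_closedBall_zero_iff, Real.norm_eq_abs, abs_le]
      intro h; exact hs ⟨by linarith [h.1, h.2], by linarith [h.1, h.2]⟩
    exact notMem_support.1 fun h => h1 (support_deriv_subset h)
  have hI : Integrable (fun s => deriv ρ (t - s) • hx s) := by
    refine ((hdc.integrable_of_hasCompactSupport hdcs).norm.mul_const M).mono'
      (hdc.aestronglyMeasurable.smul (stronglyMeasurable_driftField_at hW x).aestronglyMeasurable)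
      (Eventually.of_forall fun s => ?_)
    rw [norm_smul]
    exact mul_le_mul_of_nonneg_left (hM s x) (norm_nonneg _)
  have e1 : ⟪(deriv ρ ⋆[lsmul ℝ ℝ, volume] hx) t, c⟫ = ∫ s, deriv ρ (t - s) * ⟪driftField W s x, c⟫ := by
    rw [convolution_eq_swap]
    simp only [lsmul_apply]
    rw [real_inner_comm, ← integral_inner hI c]
    refine integral_congr_ae (Eventually.of_forall fun s => ?_)
    simp only [hhx, inner_smul_right, real_inner_comm]
  have e2 : (∫ s, deriv ρ (t - s) * ⟪driftField W s x, c⟫) = -∫ s, deriv χ s * ⟪driftField W s x, c⟫ := by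
    rw [← integral_neg]
    refine integral_congr_ae (Eventually.of_forall fun s => ?_)
    dsimp only
    rw [hχ' s]; ring
  rw [e1, e2, weak, neg_neg] at hinner
  exact hinner

end Kwon2023

end Literature.Analysis.FluidPDE

end
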